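/-
Copyright (c) 2026 the pub-hodgecm-mathlib formalisation cell (harness21).  Prover seat hodgecm-mathlib-K2E4-p14 (g5), Track B ∕ K2-LIT, h413 =
`stmt-HodgeConjecture-24833`, line `K2_E1_TraceFormulaBeta`, campaign «EIS-RANK-ONE» rung R6f(ii); DEAL «MS-TWO» tail ∕ ED. 4 of «EIS-R6-CM» (dealer K2E1-plan (g3)
2026-09-04T05:48:57Z: «then FREE → `hCT′`∕`hM′ψ` at N = 3 (★ R3 two-piece + R6a∕R6c + ★ R5a) as ED. 4 = `K2E1MaassSelbergCMThreeConstantTerms`»).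
-/
import Summits.HodgeConjecture.HodgeConjecture.Theorems.K2E1MaassSelbergCMThreeAdjoint     -- ★ p857703 (this seat): ED. 3, concrete intertwining operators
import Summits.HodgeConjecture.HodgeConjecture.Theorems.K2E1EisensteinSeriesLeftRight      -- ★ p857392 (K2E1-p09 g4): R3 `borelConstantTerm_eisensteinSeriesU_three` (`E(h)_B = h + M̄h`)
import Summits.HodgeConjecture.HodgeConjecture.Theorems.K2E1TruncatedEisensteinConstantTerm -- ★ p857469 (K2E1-p09 g4): R6c `(Λ^T E f)_B = 0` on `{H > T}`
import Summits.HodgeConjecture.HodgeConjecture.Theorems.K2E1BorelHeightWeylUnipotent       -- ★ p857424 (K2E1-p09 g4): R6a `H(w₀ n g)·H(g) ≤ 1`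
import HarnessLib

/-!
# K2·E1 — `K2E1MaassSelbergCMThreeConstantTerms`: THE MAASS–SELBERG RELATION FOR FLAT SECTIONS OF `U(J₃)` WITH THE CONSTANT-TERM INPUTS `hCT`, `hCT′`, `hM′ψ` DISCHARGED
# (campaign «EIS-RANK-ONE», rung R6f(ii), ED. 4 of «EIS-R6-CM»: ★ ED. 3 `maassSelberg_flatSectionU_three_adj` over ★ R3 ∕ ★ R6a ∕ ★ R6b ∕ ★ R6c)

Track B ∕ K2-LIT, crux h413 = `stmt-HodgeConjecture-24833`, route of record `HCCMUnconditional`; cell `hodgecm-mathlib`, squad K2, ENGINE E1.  Prover seat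
`hodgecm-mathlib-K2E4-p14` (g5); dealt by K2E1-plan (g3) 2026-09-04T05:48:57Z (REPORT-FIRST).  THEOREMS ONLY (no `def`, no `instance`, no notation, no named-fact hypothesis, no `sorry`);
lane `--supports stmt-HodgeConjecture-24833 --as helper` (count-neutral).  Closes no socket.

THE MATHEMATICS [MoeglinWaldspurger1995, I.2.13, II.1.7, IV.2.1–IV.2.3; Arthur1980TraceFormulaII, §1, §4; Garrett2018, §1.11, §2.10–§2.11, §11.3].  In ★ ED. 3 the three constant-term
inputs of the Maass–Selberg computation were NAMED: `hCT : E(f_z)_B = f_z + f̃_{2−z}` on `{H > T}`, `hCT′ : (Λ′)_B = 𝟙_{H≤T}·(f′ + f̃′) − M(𝟙_{H>T}·(f′ + f̃′))` for the second truncated series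
`Λ′`, and `hM′ψ : M′ψ = f̃_{2−z}` on `{H > T}` (`ψ = 𝟙_{H≤T} f_z − 𝟙_{H>T} f̃_{2−z}`).  Here `Λ′ := Λ^T E(f′_{z′})` is SPELLED OUT and all three are DISCHARGED, with the Haar measure
of `N(𝔸_F)` normalised by `ν(𝓕) = 1` (`vol(N(F)∖N(𝔸_F)) = 1`, so that ED. 3's un-normalised `M h (g) = ∫_{N(𝔸)} h(w₀ u g) dν` IS the constant-term intertwining operator), from:
* ★ R3 `borelConstantTerm_eisensteinSeriesU_three` — `E(h)_B(g) = h(g) + ν(𝓕)⁻¹ ∫_{N(𝔸)} h(w₀ v g) dν` for Borel left-`N(𝔸)B(F)`-invariant `h` under the Godement finiteness `hfin`,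
  applied to `h = f_z`, `h = f′_{z′}` AND to the cut-off `χ = 𝟙_{H>T}·(f′ + f̃′)` (whose `hfin` is DOMINATED by that of the standard section `H^{z′}`: on `{H > T}`,
  `|f′| + |f̃′| ≤ (C_φ′ + C_φ̃′ T^{2−2Re z′})·H^{Re z′}`, §1);
* the flat-section intertwining identities `∫_{N(𝔸)} f_z(w₀ v g) dν = f̃_{2−z}(g)`, `∫ f′_{z′}(w₀ v g) dν = f̃′_{2−z′}(g)` — the NAMED inputs `hMf`, `hMf′` (R5: the Gindikin–Karpelevich
  content lives in the coefficients `φ̃`, `φ̃′`, which stay abstract);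
* ★ R6b `truncation_def` + `constantTermTail_eisensteinSeriesU_eq` (`Λ′ = E(f′) − Ψ(χ)`), ★ `pseudoEisenstein_eq_eisensteinSeriesU′` with ★ `finite_support_indicator_out_mul` (`Ψ(χ) = E(χ)`,
  `T ≥ 1`, Siegel ★ `siegel_three`), linearity of `(·)_B` (§1 `borelConstantTerm_sub`), ★ R6c `borelConstantTerm_truncation_eisensteinSeriesU_eq_zero_of_lt_three` on `{H > T}`, and
  ★ R6a `not_lt_borelHeight_weylLongU_unipotent_mul` (`𝟙_{H>T}(w₀ u g) = 0` for `H(g) > T ≥ 1`) with `w₀⁻¹ = w₀` (★ `weylLongU_mul_weylLongU`).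
§2 **`maassSelberg_flatSectionU_three_ct`** = ★ ED. 3 with `hCT`, `hCT′`, `hM′ψ` REPLACED by `hMf`, `hMf′`, the Godement finiteness of `H^z`, `H^{z′}` in ★ R3's spelling (`hfinz`, `hfinz′` —
★ `hfin_of_locallyUniformMajorant` + ★ R4a at CM), and `hint′ : u ↦ E(f′)(u g) ∈ L¹(𝓕)` (★ `integrableOn_translate_of_continuous` + ★ R4a at CM); `Λ′ = Λ^T E(f′_{z′})` concrete (its
Borel-ness ∕ `G(F)`-invariance ∕ bound are ★ p857707's `…BoundedCMThree` heads at CM).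
NAMED INPUTS KEPT (supplier): `hMf`∕`hMf′` (R5 flat-section intertwining identity), `hfinz`∕`hfinz′`∕`hint′`∕`hsum` (★ at CM), `Λ′` Borel∕invariant∕bounded (★ p857707 ∘ `hdec`), `hψL1`,
`hi₅`, `habs`∕`habs′`, coefficient facts, `hΞᵢ`.
HONEST LABEL: HC_CM is proved only modulo the 7 printed citations (2 remaining named inputs: hLiu418 = `stmt-HodgeConjecture-24832`, h413 = `stmt-HodgeConjecture-24833`) until rung 0
closes; this file asserts no named fact and closes no socket.
References: [MoeglinWaldspurger1995] I.2.13, II.1.7, IV.2.1–IV.2.3 · [Arthur1980TraceFormulaII] §1, §4 · [Garrett2018] §1.11, §2.10–§2.11, §11.3 · [Rogawski1990] §2.1–§2.2.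
-/

set_option autoImplicit false
-- the mandated namespace repeats the single-problem summit's segment (`HodgeConjecture.HodgeConjecture`)
set_option linter.dupNamespace false

noncomputable section

open MeasureTheory Measure NumberField IsDedekindDomain Set MulAction Filter
open scoped ENNReal NNReal ComplexConjugate
open Literature.MeasureTheory.Group Literature.NumberTheory
open Literature.NumberTheory.Automorphic Literature.NumberTheory.Automorphic.UnitaryGroup AdelicGroupData
open Summit.HodgeConjecture.HodgeConjecture.Cruxes.H413.K2E1BorelEisensteinU
open Summit.HodgeConjecture.HodgeConjecture.Cruxes.H413.K2E1MaassSelbergBracketsThree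
open Summit.HodgeConjecture.HodgeConjecture.Cruxes.H413.K2E1MaassSelbergCMThree (indicator_height_apply_eq)
open Summit.HodgeConjecture.HodgeConjecture.Cruxes.H413.K2E1MaassSelbergCMThreeAdjoint
open Summit.HodgeConjecture.HodgeConjecture.Cruxes.H413.K2E1TruncatedEisensteinExplicit (forall_arithmeticBorel_indicator constantTermTail_eisensteinSeriesU_eq finite_support_indicator_out_mul siegel_three)
open Summit.HodgeConjecture.HodgeConjecture.Cruxes.H413.K2E1BorelCosetsDictionary (pseudoEisenstein_eq_eisensteinSeriesU' forall_arithmeticBorel_iff)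
open Summit.HodgeConjecture.HodgeConjecture.Cruxes.H413.K2E1EisensteinSeriesLeftRight (borelConstantTerm_eisensteinSeriesU_three)
open Summit.HodgeConjecture.HodgeConjecture.Cruxes.H413.K2E1TruncatedEisensteinConstantTerm (borelConstantTerm_truncation_eisensteinSeriesU_eq_zero_of_lt_three)
open Summit.HodgeConjecture.HodgeConjecture.Cruxes.H413.K2E1BorelHeightWeylUnipotent (not_lt_borelHeight_weylLongU_unipotent_mul)

namespace Summit.HodgeConjecture.HodgeConjecture.Cruxes.H413.K2E1MaassSelbergCMThreeConstantTerms

variable {F E : Type} [Field F] [NumberField F] [Field E] [NumberField E] [Algebra F E] {c : E ≃ₐ[F] E} {N : ℕ} [NeZero N]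

/-! ## §1 Three small tools: linearity of `(·)_B`, Godement finiteness by domination, the cut-off `χ` is dominated by the standard section -/

omit [NeZero N] in
/-- The Borel constant term is subtractive in `φ` (on integrable data; companion of ★ `borelConstantTerm_add`). [cite: Rogawski1990, §2.1] -/
theorem borelConstantTerm_sub [MeasurableSpace (adelicUnipotent F E c N)] (ν : Measure (adelicUnipotent F E c N)) (𝓕 : Set (adelicUnipotent F E c N))
    {φ ψ : (quasiSplit F E c N).Adelic → ℂ} (g : (quasiSplit F E c N).Adelic)
    (hφ : IntegrableOn (fun u : adelicUnipotent F E c N => φ ((u : (quasiSplit F E c N).Adelic) * g)) 𝓕 ν)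
    (hψ : IntegrableOn (fun u : adelicUnipotent F E c N => ψ ((u : (quasiSplit F E c N).Adelic) * g)) 𝓕 ν) :
    borelConstantTerm ν 𝓕 (φ - ψ) g = borelConstantTerm ν 𝓕 φ g - borelConstantTerm ν 𝓕 ψ g := by
  simp only [borelConstantTerm_def, Pi.sub_apply]
  rw [integral_sub hφ hψ, smul_sub]

omit [NeZero N] in
/-- **GODEMENT FINITENESS BY DOMINATION**: if `‖h‖ ≤ C·‖h₀‖` pointwise, the `hfin` binder of ★ R3 (`∫⁻_{u∈𝓕} Σ'_{p∈Γ⧸B_Γ} ‖h(p̃⁻¹ u g)‖ₑ dν < ∞`) passes from `h₀` to `h`.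
[cite: MoeglinWaldspurger1995, II.1.5] -/
theorem hfin_of_norm_le [MeasurableSpace (quasiSplit F E c N).Adelic] {ν : Measure ↥(adelicUnipotent F E c N)} {𝓕 : Set ↥(adelicUnipotent F E c N)}
    {h h₀ : (quasiSplit F E c N).Adelic → ℂ} {C : ℝ} (hC : 0 ≤ C) (hle : ∀ y, ‖h y‖ ≤ C * ‖h₀ y‖) (g : (quasiSplit F E c N).Adelic)
    (h₀fin : ∫⁻ u in 𝓕, (∑' q : (quasiSplit F E c N).quotientSubgroup ⧸ (borelAdelic F E c N).subgroupOf (quasiSplit F E c N).quotientSubgroup,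
        ‖h₀ ((((q.out : (quasiSplit F E c N).quotientSubgroup) : (quasiSplit F E c N).Adelic))⁻¹ * (u : (quasiSplit F E c N).Adelic) * g)‖ₑ) ∂ν < ∞) :
    ∫⁻ u in 𝓕, (∑' q : (quasiSplit F E c N).quotientSubgroup ⧸ (borelAdelic F E c N).subgroupOf (quasiSplit F E c N).quotientSubgroup,
        ‖h ((((q.out : (quasiSplit F E c N).quotientSubgroup) : (quasiSplit F E c N).Adelic))⁻¹ * (u : (quasiSplit F E c N).Adelic) * g)‖ₑ) ∂ν < ∞ := by
  have hpt : ∀ y, ‖h y‖ₑ ≤ ENNReal.ofReal C * ‖h₀ y‖ₑ := fun y => by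
    rw [← ofReal_norm, ← ofReal_norm, ← ENNReal.ofReal_mul hC]; exact ENNReal.ofReal_le_ofReal (hle y)
  refine lt_of_le_of_lt (lintegral_mono fun u => (ENNReal.tsum_le_tsum fun q => hpt _).trans_eq ENNReal.tsum_mul_left) ?_
  rw [lintegral_const_mul' _ _ ENNReal.ofReal_ne_top]
  exact ENNReal.mul_lt_top ENNReal.ofReal_lt_top h₀fin

/-- A flat section with bounded coefficient is dominated by the standard section: `‖(α·H^a)(y)‖ ≤ C_α·‖(1·H^a)(y)‖`. [cite: MoeglinWaldspurger1995, II.1.5] -/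
theorem norm_flatSectionU_le_mul_norm_std {α : (quasiSplit F E c N).Adelic → ℂ} {Cα : ℝ} (hα : ∀ x, ‖α x‖ ≤ Cα) (a : ℂ) (y : (quasiSplit F E c N).Adelic) :
    ‖flatSectionU α a y‖ ≤ Cα * ‖flatSectionU (fun _ : (quasiSplit F E c N).Adelic => (1 : ℂ)) a y‖ := by
  rw [flatSectionU_apply, flatSectionU_apply, one_mul, norm_mul]
  exact mul_le_mul_of_nonneg_right (hα y) (norm_nonneg _)

/-- **THE CUT-OFF `χ = 𝟙_{H>T}·(f′_{z′} + f̃′_{2−z′})` IS DOMINATED BY THE STANDARD SECTION `H^{z′}`** (`0 < T`, `1 ≤ Re z′`): on `{H > T}`, `|α′|·H^{Re z′} + |α̃′|·H^{2−Re z′} ≤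
(C_α′ + C_α̃′·T^{2−2Re z′})·H^{Re z′}` since `H^{2−2Re z′} ≤ T^{2−2Re z′}` there. [cite: MoeglinWaldspurger1995, II.1.5] -/
theorem norm_indicator_lt_add_flatSectionU_le {α α' : (quasiSplit F E c N).Adelic → ℂ} {Cα Cα' : ℝ} (hα : ∀ x, ‖α x‖ ≤ Cα) (hα' : ∀ x, ‖α' x‖ ≤ Cα')
    {T : ℝ≥0} (hT : 0 < T) {z' : ℂ} (hz' : 1 ≤ z'.re) (y : (quasiSplit F E c N).Adelic) :
    ‖{y : (quasiSplit F E c N).Adelic | T < borelHeight y}.indicator (flatSectionU α z' + flatSectionU α' (2 - z')) y‖ ≤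
      (Cα + Cα' * (T : ℝ) ^ (2 - 2 * z'.re)) * ‖flatSectionU (fun _ : (quasiSplit F E c N).Adelic => (1 : ℂ)) z' y‖ := by
  have hpos : (0 : ℝ) < (borelHeight y : ℝ) := by exact_mod_cast borelHeight_pos y
  have h1 : ‖flatSectionU (fun _ : (quasiSplit F E c N).Adelic => (1 : ℂ)) z' y‖ = (borelHeight y : ℝ) ^ z'.re := by
    rw [flatSectionU_apply, one_mul, Complex.norm_cpow_eq_rpow_re_of_pos hpos]
  have hCα : 0 ≤ Cα := (norm_nonneg _).trans (hα y)
  have hCα' : 0 ≤ Cα' := (norm_nonneg _).trans (hα' y)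
  have hTe : 0 ≤ (T : ℝ) ^ (2 - 2 * z'.re) := Real.rpow_nonneg (NNReal.coe_nonneg T) _
  rw [h1]
  by_cases hy : T < borelHeight y
  · rw [indicator_of_mem (show y ∈ {y : (quasiSplit F E c N).Adelic | T < borelHeight y} from hy), Pi.add_apply]
    have hTH : (T : ℝ) ≤ (borelHeight y : ℝ) := le_of_lt (by exact_mod_cast hy)
    have h2re : ((2 : ℂ) - z').re = (2 - 2 * z'.re) + z'.re := by simp only [Complex.sub_re]; norm_num; ring
    have hf : ‖flatSectionU α z' y‖ ≤ Cα * (borelHeight y : ℝ) ^ z'.re := by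
      rw [flatSectionU_apply, norm_mul, Complex.norm_cpow_eq_rpow_re_of_pos hpos]
      exact mul_le_mul_of_nonneg_right (hα y) (Real.rpow_nonneg hpos.le _)
    have hM : ‖flatSectionU α' (2 - z') y‖ ≤ Cα' * (T : ℝ) ^ (2 - 2 * z'.re) * (borelHeight y : ℝ) ^ z'.re := by
      rw [flatSectionU_apply, norm_mul, Complex.norm_cpow_eq_rpow_re_of_pos hpos, h2re, Real.rpow_add hpos, mul_assoc]
      exact mul_le_mul (hα' y) (mul_le_mul_of_nonneg_right (Real.rpow_le_rpow_of_nonpos (NNReal.coe_pos.2 hT) hTH (by linarith)) (Real.rpow_nonneg hpos.le _))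
        (by positivity) hCα'
    calc ‖flatSectionU α z' y + flatSectionU α' (2 - z') y‖ ≤ ‖flatSectionU α z' y‖ + ‖flatSectionU α' (2 - z') y‖ := norm_add_le _ _
      _ ≤ Cα * (borelHeight y : ℝ) ^ z'.re + Cα' * (T : ℝ) ^ (2 - 2 * z'.re) * (borelHeight y : ℝ) ^ z'.re := add_le_add hf hM
      _ = (Cα + Cα' * (T : ℝ) ^ (2 - 2 * z'.re)) * (borelHeight y : ℝ) ^ z'.re := by ring
  · rw [indicator_of_notMem (show y ∉ {y : (quasiSplit F E c N).Adelic | T < borelHeight y} from hy), norm_zero]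
    exact mul_nonneg (add_nonneg hCα (mul_nonneg hCα' hTe)) (Real.rpow_nonneg hpos.le _)

/-! ## §2 ED. 4: `hCT`, `hCT′`, `hM′ψ` discharged (`Λ′ := Λ^T E(f′_{z′})`, `ν(𝓕) = 1`) -/

section ConstantTerms

variable [MeasurableSpace (quasiSplit F E c 3).Adelic] [BorelSpace (quasiSplit F E c 3).Adelic]
variable [MeasurableSpace (AdeleRing (𝓞 E) E)ˣ] [BorelSpace (AdeleRing (𝓞 E) E)ˣ]

/-- **THE MAASS–SELBERG RELATION FOR FLAT SECTIONS OF `U(J₃)` — CONSTANT TERMS DISCHARGED.**  ★ ED. 3 `maassSelberg_flatSectionU_three_adj` with the second truncated series spelled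
`Λ′ := Λ^T E(f′_{z′})`, the Haar measure of `N(𝔸_F)` normalised by `ν(𝓕) = 1`, and the three constant-term hypotheses `hCT`, `hCT′`, `hM′ψ` PROVED from ★ R3 (for `f_z`, `f′_{z′}` and the
cut-off `χ`), ★ R6b∕R6c, ★ R6a and the named flat-section intertwining identities `hMf`, `hMf′`; what remains named is listed in the module docstring.
[cite: MoeglinWaldspurger1995, I.2.13, II.1.7 and IV.2.1–IV.2.3] [cite: Arthur1980TraceFormulaII, §1 and §4] [cite: Garrett2018, §1.11, §2.10–§2.11 and §11.3] -/
theorem maassSelberg_flatSectionU_three_ct (h2 : Module.finrank F E = 2) (hc : c * c = 1) (hc1 : c ≠ 1)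
    (μ : Measure (quasiSplit F E c 3).automorphicQuotient) [(quasiSplit F E c 3).IsAutomorphicMeasure μ]
    (νG : Measure (quasiSplit F E c 3).Adelic) [νG.IsHaarMeasure] [νG.IsInvInvariant]
    (μK : Measure ((standardMaximalCompactGL 3 E).comap (adelicVal F E c 3 ((StdForm.antidiagonal 3).over E)) : Subgroup (quasiSplit F E c 3).Adelic))
    [μK.IsHaarMeasure]
    (νI : Measure (AdeleRing (𝓞 E) E)ˣ) [νI.IsHaarMeasure]
    (hBK : ∀ g : (quasiSplit F E c 3).Adelic, ∃ b ∈ borelAdelic F E c 3, ∃ k : (quasiSplit F E c 3).Adelic,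
      adelicVal F E c 3 ((StdForm.antidiagonal 3).over E) k ∈ standardMaximalCompactGL 3 E ∧ g = b * k)
    {𝓕I : Set (AdeleRing (𝓞 E) E)ˣ} (h𝓕I : IsIdeleClassDomain E 𝓕I)
    (ν : Measure ↥(adelicUnipotent F E c 3)) [ν.IsHaarMeasure] [ν.IsInvInvariant]
    {𝓕 : Set ↥(adelicUnipotent F E c 3)} (h𝓕N : IsFundamentalDomain ↥(rationalUnipotent F E c 3) 𝓕 ν) (h𝓕1 : ν 𝓕 = 1) :
    ∃ cμ K : ℝ, 0 < cμ ∧ 0 < K ∧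
      ∀ {β : (quasiSplit F E c 3).Adelic → ℝ≥0∞}, IsCoveringWeight ((arithmeticBorel F E c 3).map (quasiSplit F E c 3).arithmeticSubgroup.subtype) β →
      ∀ {T : ℝ≥0}, 1 ≤ T →
      ∀ {φ φ' φt φt' : (quasiSplit F E c 3).Adelic → ℂ},
      Measurable φ →
        (∀ (n : unipotentInBorel F E c 3) (y : (quasiSplit F E c 3).Adelic), φ (((n : borelAdelic F E c 3) : (quasiSplit F E c 3).Adelic) * y) = φ y) →
        (∀ b ∈ arithmeticBorel F E c 3, ∀ y : (quasiSplit F E c 3).Adelic, φ ((b : (quasiSplit F E c 3).Adelic) * y) = φ y) →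
      ∀ {Cφ : ℝ}, (∀ x, ‖φ x‖ ≤ Cφ) →
      Measurable φ' →
        (∀ (n : unipotentInBorel F E c 3) (y : (quasiSplit F E c 3).Adelic), φ' (((n : borelAdelic F E c 3) : (quasiSplit F E c 3).Adelic) * y) = φ' y) →
        (∀ b ∈ arithmeticBorel F E c 3, ∀ y : (quasiSplit F E c 3).Adelic, φ' ((b : (quasiSplit F E c 3).Adelic) * y) = φ' y) →
      ∀ {Cφ' : ℝ}, (∀ x, ‖φ' x‖ ≤ Cφ') →
      Measurable φt →
        (∀ (n : unipotentInBorel F E c 3) (y : (quasiSplit F E c 3).Adelic), φt (((n : borelAdelic F E c 3) : (quasiSplit F E c 3).Adelic) * y) = φt y) →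
        (∀ b ∈ arithmeticBorel F E c 3, ∀ y : (quasiSplit F E c 3).Adelic, φt ((b : (quasiSplit F E c 3).Adelic) * y) = φt y) →
      ∀ {Cφt : ℝ}, (∀ x, ‖φt x‖ ≤ Cφt) →
      Measurable φt' →
        (∀ (n : unipotentInBorel F E c 3) (y : (quasiSplit F E c 3).Adelic), φt' (((n : borelAdelic F E c 3) : (quasiSplit F E c 3).Adelic) * y) = φt' y) →
        (∀ b ∈ arithmeticBorel F E c 3, ∀ y : (quasiSplit F E c 3).Adelic, φt' ((b : (quasiSplit F E c 3).Adelic) * y) = φt' y) →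
      ∀ {Cφt' : ℝ}, (∀ x, ‖φt' x‖ ≤ Cφt') →
      ∀ {z z' : ℂ}, 2 < z'.re → z'.re < z.re →
      -- NAMED: the flat-section intertwining identities `M(w₀) f_z = f̃_{2−z}`, `M(w₀) f′_{z′} = f̃′_{2−z′}` (R5) and the Godement finiteness of the STANDARD sections `H^z`, `H^{z′}` (R2∕R4a)
        (∀ g : (quasiSplit F E c 3).Adelic, ∫ v : ↥(adelicUnipotent F E c 3), flatSectionU φ z ((quasiSplit F E c 3).toAdelic (weylLongU (c : E →+* E) (rfl : (StdForm.antidiagonal 3).over E = (StdForm.antidiagonal 3).over E)) * ((v : (quasiSplit F E c 3).Adelic) * g)) ∂ν = flatSectionU φt (2 - z) g) →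
        (∀ g : (quasiSplit F E c 3).Adelic, ∫ v : ↥(adelicUnipotent F E c 3), flatSectionU φ' z' ((quasiSplit F E c 3).toAdelic (weylLongU (c : E →+* E) (rfl : (StdForm.antidiagonal 3).over E = (StdForm.antidiagonal 3).over E)) * ((v : (quasiSplit F E c 3).Adelic) * g)) ∂ν = flatSectionU φt' (2 - z') g) →
        (∀ g : (quasiSplit F E c 3).Adelic, ∫⁻ u in 𝓕, (∑' q : (quasiSplit F E c 3).quotientSubgroup ⧸ (borelAdelic F E c 3).subgroupOf (quasiSplit F E c 3).quotientSubgroup,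
            ‖flatSectionU (fun _ : (quasiSplit F E c 3).Adelic => (1 : ℂ)) z ((((q.out : (quasiSplit F E c 3).quotientSubgroup) : (quasiSplit F E c 3).Adelic))⁻¹ * (u : (quasiSplit F E c 3).Adelic) * g)‖ₑ) ∂ν < ∞) →
        (∀ g : (quasiSplit F E c 3).Adelic, ∫⁻ u in 𝓕, (∑' q : (quasiSplit F E c 3).quotientSubgroup ⧸ (borelAdelic F E c 3).subgroupOf (quasiSplit F E c 3).quotientSubgroup,
            ‖flatSectionU (fun _ : (quasiSplit F E c 3).Adelic => (1 : ℂ)) z' ((((q.out : (quasiSplit F E c 3).quotientSubgroup) : (quasiSplit F E c 3).Adelic))⁻¹ * (u : (quasiSplit F E c 3).Adelic) * g)‖ₑ) ∂ν < ∞) →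
        (∀ g : (quasiSplit F E c 3).Adelic,
          Summable fun q : Quotient (orbitRel ↥(borelU (c : E →+* E) ((StdForm.antidiagonal 3).over E)) ↥(unitaryGroupOfForm (c : E →+* E) ((StdForm.antidiagonal 3).over E))) =>
            flatSectionU φ z ((quasiSplit F E c 3).toAdelic (q.out : ↥(unitaryGroupOfForm (c : E →+* E) ((StdForm.antidiagonal 3).over E))) * g)) →
      -- the truncated second series `Λ′ := Λ^T E(f′_{z′})`: Borel, `G(F)`-invariant, bounded (★ R6e ∕ p857707 at CM), and its Eisenstein series integrable along `N(F)∖N(𝔸)·g` (R4a)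
        Measurable (truncation ν 𝓕 T (eisensteinSeriesU (flatSectionU φ' z'))) →
        (∀ (γ : (quasiSplit F E c 3).arithmeticSubgroup) (x : (quasiSplit F E c 3).Adelic), truncation ν 𝓕 T (eisensteinSeriesU (flatSectionU φ' z')) ((γ : (quasiSplit F E c 3).Adelic) * x) = truncation ν 𝓕 T (eisensteinSeriesU (flatSectionU φ' z')) x) →
        ∀ {M₁ : ℝ}, (∀ g, ‖truncation ν 𝓕 T (eisensteinSeriesU (flatSectionU φ' z')) g‖ ≤ M₁) →
        (∀ g : (quasiSplit F E c 3).Adelic, IntegrableOn (fun u : ↥(adelicUnipotent F E c 3) => eisensteinSeriesU (flatSectionU φ' z') ((u : (quasiSplit F E c 3).Adelic) * g)) 𝓕 ν) →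
        ∫⁻ g, β g * ‖({y : (quasiSplit F E c 3).Adelic | borelHeight y ≤ T}.indicator (flatSectionU φ z) g - {y : (quasiSplit F E c 3).Adelic | T < borelHeight y}.indicator (flatSectionU φt (2 - z)) g)‖ₑ ∂νG < ∞ →
        Integrable (fun g => (β g).toReal • (({y : (quasiSplit F E c 3).Adelic | borelHeight y ≤ T}.indicator (flatSectionU φ z) g - {y : (quasiSplit F E c 3).Adelic | T < borelHeight y}.indicator (flatSectionU φt (2 - z)) g) * conj (∫ u : ↥(adelicUnipotent F E c 3), {y : (quasiSplit F E c 3).Adelic | T < borelHeight y}.indicator (flatSectionU φ' z' + flatSectionU φt' (2 - z')) ((quasiSplit F E c 3).toAdelic (weylLongU (c : E →+* E) (rfl : (StdForm.antidiagonal 3).over E = (StdForm.antidiagonal 3).over E)) * ((u : (quasiSplit F E c 3).Adelic) * g)) ∂ν))) νG →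
      -- ★ p857605's absolute convergence (`h := χ`, `F := ψ`)
        ∫⁻ g, β g * ∫⁻ u : ↥(adelicUnipotent F E c 3), ‖{y : (quasiSplit F E c 3).Adelic | T < borelHeight y}.indicator (flatSectionU φ' z' + flatSectionU φt' (2 - z')) ((quasiSplit F E c 3).toAdelic (weylLongU (c : E →+* E) (rfl : (StdForm.antidiagonal 3).over E = (StdForm.antidiagonal 3).over E)) * ((u : (quasiSplit F E c 3).Adelic) * g)) * conj ({y : (quasiSplit F E c 3).Adelic | borelHeight y ≤ T}.indicator (flatSectionU φ z) g - {y : (quasiSplit F E c 3).Adelic | T < borelHeight y}.indicator (flatSectionU φt (2 - z)) g)‖ₑ ∂ν ∂νG < ∞ →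
        ∫⁻ g, β g * ∫⁻ u : ↥(adelicUnipotent F E c 3), ‖{y : (quasiSplit F E c 3).Adelic | T < borelHeight y}.indicator (flatSectionU φ' z' + flatSectionU φt' (2 - z')) g * conj ({y : (quasiSplit F E c 3).Adelic | borelHeight y ≤ T}.indicator (flatSectionU φ z) (((quasiSplit F E c 3).toAdelic (weylLongU (c : E →+* E) (rfl : (StdForm.antidiagonal 3).over E = (StdForm.antidiagonal 3).over E)))⁻¹ * ((u : (quasiSplit F E c 3).Adelic) * g)) - {y : (quasiSplit F E c 3).Adelic | T < borelHeight y}.indicator (flatSectionU φt (2 - z)) (((quasiSplit F E c 3).toAdelic (weylLongU (c : E →+* E) (rfl : (StdForm.antidiagonal 3).over E = (StdForm.antidiagonal 3).over E)))⁻¹ * ((u : (quasiSplit F E c 3).Adelic) * g)))‖ₑ ∂ν ∂νG < ∞ →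
      ∀ {Ξ₁ Ξ₂ Ξ₃ Ξ₄ : (AdeleRing (𝓞 E) E)ˣ → ℂ},
      Measurable Ξ₁ → ∀ {CΞ₁ : ℝ}, (∀ x, ‖Ξ₁ x‖ ≤ CΞ₁) → (∀ k ∈ GaloisRepresentations.principalIdeles E, ∀ x, Ξ₁ (k * x) = Ξ₁ x) →
        (∀ (r : ℝ≥0ˣ) (x : (AdeleRing (𝓞 E) E)ˣ), Ξ₁ (posRealIdele E r * x) = Ξ₁ x) →
        (∀ t : torusInBorel F E c 3,
          ∫ k, φ (((t : borelAdelic F E c 3) : (quasiSplit F E c 3).Adelic) * (k : (quasiSplit F E c 3).Adelic)) *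
              conj (φ' (((t : borelAdelic F E c 3) : (quasiSplit F E c 3).Adelic) * (k : (quasiSplit F E c 3).Adelic))) ∂μK = Ξ₁ (diagUnit (t : borelAdelic F E c 3).2 0)) →
      Measurable Ξ₂ → ∀ {CΞ₂ : ℝ}, (∀ x, ‖Ξ₂ x‖ ≤ CΞ₂) → (∀ k ∈ GaloisRepresentations.principalIdeles E, ∀ x, Ξ₂ (k * x) = Ξ₂ x) →
        (∀ (r : ℝ≥0ˣ) (x : (AdeleRing (𝓞 E) E)ˣ), Ξ₂ (posRealIdele E r * x) = Ξ₂ x) →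
        (∀ t : torusInBorel F E c 3,
          ∫ k, φ (((t : borelAdelic F E c 3) : (quasiSplit F E c 3).Adelic) * (k : (quasiSplit F E c 3).Adelic)) *
              conj (φt' (((t : borelAdelic F E c 3) : (quasiSplit F E c 3).Adelic) * (k : (quasiSplit F E c 3).Adelic))) ∂μK = Ξ₂ (diagUnit (t : borelAdelic F E c 3).2 0)) →
      Measurable Ξ₃ → ∀ {CΞ₃ : ℝ}, (∀ x, ‖Ξ₃ x‖ ≤ CΞ₃) → (∀ k ∈ GaloisRepresentations.principalIdeles E, ∀ x, Ξ₃ (k * x) = Ξ₃ x) →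
        (∀ (r : ℝ≥0ˣ) (x : (AdeleRing (𝓞 E) E)ˣ), Ξ₃ (posRealIdele E r * x) = Ξ₃ x) →
        (∀ t : torusInBorel F E c 3,
          ∫ k, φt (((t : borelAdelic F E c 3) : (quasiSplit F E c 3).Adelic) * (k : (quasiSplit F E c 3).Adelic)) *
              conj (φ' (((t : borelAdelic F E c 3) : (quasiSplit F E c 3).Adelic) * (k : (quasiSplit F E c 3).Adelic))) ∂μK = Ξ₃ (diagUnit (t : borelAdelic F E c 3).2 0)) →
      Measurable Ξ₄ → ∀ {CΞ₄ : ℝ}, (∀ x, ‖Ξ₄ x‖ ≤ CΞ₄) → (∀ k ∈ GaloisRepresentations.principalIdeles E, ∀ x, Ξ₄ (k * x) = Ξ₄ x) →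
        (∀ (r : ℝ≥0ˣ) (x : (AdeleRing (𝓞 E) E)ˣ), Ξ₄ (posRealIdele E r * x) = Ξ₄ x) →
        (∀ t : torusInBorel F E c 3,
          ∫ k, φt (((t : borelAdelic F E c 3) : (quasiSplit F E c 3).Adelic) * (k : (quasiSplit F E c 3).Adelic)) *
              conj (φt' (((t : borelAdelic F E c 3) : (quasiSplit F E c 3).Adelic) * (k : (quasiSplit F E c 3).Adelic))) ∂μK = Ξ₄ (diagUnit (t : borelAdelic F E c 3).2 0)) →
        ∫ x, (quasiSplit F E c 3).quotFun (truncation ν 𝓕 T (eisensteinSeriesU (flatSectionU φ z))) x * conj ((quasiSplit F E c 3).quotFun (truncation ν 𝓕 T (eisensteinSeriesU (flatSectionU φ' z'))) x) ∂μ =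
          (cμ : ℂ) * ((K : ℂ) *
            ((((T : ℝ) : ℂ) ^ (z + conj z' - 2) / (z + conj z' - 2)) * (∫ x in {x : (AdeleRing (𝓞 E) E)ˣ | (IdeleClassGroup.ideleNorm E x : ℝ) ≤ 1} ∩ 𝓕I, ((IdeleClassGroup.ideleNorm E x : ℝ) : ℂ) * Ξ₁ x ∂νI)
              + (((T : ℝ) : ℂ) ^ (z - conj z') / (z - conj z')) * (∫ x in {x : (AdeleRing (𝓞 E) E)ˣ | (IdeleClassGroup.ideleNorm E x : ℝ) ≤ 1} ∩ 𝓕I, ((IdeleClassGroup.ideleNorm E x : ℝ) : ℂ) * Ξ₂ x ∂νI)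
              - (((T : ℝ) : ℂ) ^ (-(z - conj z')) / (z - conj z')) * (∫ x in {x : (AdeleRing (𝓞 E) E)ˣ | (IdeleClassGroup.ideleNorm E x : ℝ) ≤ 1} ∩ 𝓕I, ((IdeleClassGroup.ideleNorm E x : ℝ) : ℂ) * Ξ₃ x ∂νI)
              - (((T : ℝ) : ℂ) ^ (-(z + conj z' - 2)) / (z + conj z' - 2)) * (∫ x in {x : (AdeleRing (𝓞 E) E)ˣ | (IdeleClassGroup.ideleNorm E x : ℝ) ≤ 1} ∩ 𝓕I, ((IdeleClassGroup.ideleNorm E x : ℝ) : ℂ) * Ξ₄ x ∂νI))) := by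
  have h𝓕₀ : ν 𝓕 ≠ 0 := by rw [h𝓕1]; exact one_ne_zero
  have h𝓕top : ν 𝓕 ≠ ∞ := by rw [h𝓕1]; exact ENNReal.one_ne_top
  obtain ⟨cμ, K, hcμ, hK, hAdj⟩ := maassSelberg_flatSectionU_three_adj h2 hc hc1 μ νG μK νI hBK h𝓕I ν h𝓕N h𝓕₀ h𝓕top
  refine ⟨cμ, K, hcμ, hK, ?_⟩
  intro β hβ T hT φ φ' φt φt' hφm hφN hφB Cφ hφC hφ'm hφ'N hφ'B Cφ' hφ'C hφtm hφtN hφtB Cφt hφtC hφt'm hφt'N hφt'B Cφt' hφt'C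
    z z' hz' hzz' hMf hMf' hfinz hfinz' hsum hΛm hΛG M₁ hΛbdd hint' hψL1 hi₅ habs habs'
    Ξ₁ Ξ₂ Ξ₃ Ξ₄ hΞ₁m CΞ₁ hΞ₁C hΞ₁K hΞ₁M hΞ₁ hΞ₂m CΞ₂ hΞ₂C hΞ₂K hΞ₂M hΞ₂ hΞ₃m CΞ₃ hΞ₃C hΞ₃K hΞ₃M hΞ₃ hΞ₄m CΞ₄ hΞ₄C hΞ₄K hΞ₄M hΞ₄
  have hT0 : (0 : ℝ≥0) < T := lt_of_lt_of_le one_pos hT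
  -- (0) invariances of the flat sections
  have hfB : ∀ {α : (quasiSplit F E c 3).Adelic → ℂ}, (∀ b ∈ arithmeticBorel F E c 3, ∀ y : (quasiSplit F E c 3).Adelic, α ((b : (quasiSplit F E c 3).Adelic) * y) = α y) →
      ∀ (a : ℂ), ∀ b ∈ arithmeticBorel F E c 3, ∀ x : (quasiSplit F E c 3).Adelic, flatSectionU α a ((b : (quasiSplit F E c 3).Adelic) * x) = flatSectionU α a x := by
    intro α hαB a b hb x
    rw [flatSectionU_apply, flatSectionU_apply, hαB b hb x, borelHeight_arithmeticBorel_mul hb]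
  have hfN : ∀ {α : (quasiSplit F E c 3).Adelic → ℂ}, (∀ (n : unipotentInBorel F E c 3) (y : (quasiSplit F E c 3).Adelic), α (((n : borelAdelic F E c 3) : (quasiSplit F E c 3).Adelic) * y) = α y) →
      ∀ (a : ℂ), ∀ u ∈ adelicUnipotent F E c 3, ∀ x : (quasiSplit F E c 3).Adelic, flatSectionU α a (u * x) = flatSectionU α a x := by
    intro α hαN a u hu x
    rw [flatSectionU_apply, flatSectionU_apply, hαN ⟨⟨u, adelicUnipotent_le_borelAdelic hu⟩, (mem_unipotentInBorel_iff _).2 hu⟩ x, borelHeight_unipotent_mul hu x]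
  have hfN' : ∀ {α : (quasiSplit F E c 3).Adelic → ℂ}, (∀ (n : unipotentInBorel F E c 3) (y : (quasiSplit F E c 3).Adelic), α (((n : borelAdelic F E c 3) : (quasiSplit F E c 3).Adelic) * y) = α y) →
      ∀ (a : ℂ) (u : ↥(adelicUnipotent F E c 3)) (x : (quasiSplit F E c 3).Adelic), flatSectionU α a ((u : (quasiSplit F E c 3).Adelic) * x) = flatSectionU α a x := fun hαN a u x => hfN hαN a u.1 u.2 x
  have hCφ : 0 ≤ Cφ := (norm_nonneg _).trans (hφC 1)
  have hCφ' : 0 ≤ Cφ' := (norm_nonneg _).trans (hφ'C 1)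
  have hCφt' : 0 ≤ Cφt' := (norm_nonneg _).trans (hφt'C 1)
  -- (1) `w₀⁻¹ = w₀`
  have hw0i : (weylLongU (c : E →+* E) (rfl : (StdForm.antidiagonal 3).over E = (StdForm.antidiagonal 3).over E))⁻¹ = weylLongU (c : E →+* E) rfl :=
    inv_eq_of_mul_eq_one_right (weylLongU_mul_weylLongU (c : E →+* E) rfl)
  have hW : ((quasiSplit F E c 3).toAdelic (weylLongU (c : E →+* E) (rfl : (StdForm.antidiagonal 3).over E = (StdForm.antidiagonal 3).over E)))⁻¹ = (quasiSplit F E c 3).toAdelic (weylLongU (c : E →+* E) (rfl : (StdForm.antidiagonal 3).over E = (StdForm.antidiagonal 3).over E)) := by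
    rw [← map_inv]
    exact congrArg _ hw0i
  -- (2) ★ R3 for `f_z` and `f′_{z′}` (Godement finiteness by domination from the standard sections), then `hMf`, `hMf′`: the constant terms EVERYWHERE
  have hCTf : ∀ x : (quasiSplit F E c 3).Adelic, borelConstantTerm ν 𝓕 (eisensteinSeriesU (flatSectionU φ z)) x = flatSectionU φ z x + flatSectionU φt (2 - z) x := by
    intro x
    rw [borelConstantTerm_eisensteinSeriesU_three ν (measurable_flatSectionU hφm z) (hfN' hφN z) (forall_arithmeticBorel_iff.1 (hfB hφB z)) h𝓕N h𝓕₀ h𝓕top x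
      (hfin_of_norm_le hCφ (norm_flatSectionU_le_mul_norm_std hφC z) x (hfinz x)), h𝓕1, ENNReal.toReal_one, inv_one, one_smul]
    simp_rw [mul_assoc]
    rw [hMf x]
  have hCTf' : ∀ x : (quasiSplit F E c 3).Adelic, borelConstantTerm ν 𝓕 (eisensteinSeriesU (flatSectionU φ' z')) x = flatSectionU φ' z' x + flatSectionU φt' (2 - z') x := by
    intro x
    rw [borelConstantTerm_eisensteinSeriesU_three ν (measurable_flatSectionU hφ'm z') (hfN' hφ'N z') (forall_arithmeticBorel_iff.1 (hfB hφ'B z')) h𝓕N h𝓕₀ h𝓕top x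
      (hfin_of_norm_le hCφ' (norm_flatSectionU_le_mul_norm_std hφ'C z') x (hfinz' x)), h𝓕1, ENNReal.toReal_one, inv_one, one_smul]
    simp_rw [mul_assoc]
    rw [hMf' x]
  -- (3) `hM′ψ` from ★ R6a: for `H(g) > T ≥ 1` every `w₀ u g` is low, so `ψ(w₀ u g) = f_z(w₀ u g)`, and `hMf`
  have hM'ψ : ∀ g : (quasiSplit F E c 3).Adelic, T < borelHeight g → (∫ u : ↥(adelicUnipotent F E c 3), ({y : (quasiSplit F E c 3).Adelic | borelHeight y ≤ T}.indicator (flatSectionU φ z) (((quasiSplit F E c 3).toAdelic (weylLongU (c : E →+* E) (rfl : (StdForm.antidiagonal 3).over E = (StdForm.antidiagonal 3).over E)))⁻¹ * ((u : (quasiSplit F E c 3).Adelic) * g)) - {y : (quasiSplit F E c 3).Adelic | T < borelHeight y}.indicator (flatSectionU φt (2 - z)) (((quasiSplit F E c 3).toAdelic (weylLongU (c : E →+* E) (rfl : (StdForm.antidiagonal 3).over E = (StdForm.antidiagonal 3).over E)))⁻¹ * ((u : (quasiSplit F E c 3).Adelic) * g))) ∂ν) = flatSectionU φt (2 - z) g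 := by
    intro g hg
    have hpt : ∀ u : ↥(adelicUnipotent F E c 3), {y : (quasiSplit F E c 3).Adelic | borelHeight y ≤ T}.indicator (flatSectionU φ z) (((quasiSplit F E c 3).toAdelic (weylLongU (c : E →+* E) (rfl : (StdForm.antidiagonal 3).over E = (StdForm.antidiagonal 3).over E)))⁻¹ * ((u : (quasiSplit F E c 3).Adelic) * g)) - {y : (quasiSplit F E c 3).Adelic | T < borelHeight y}.indicator (flatSectionU φt (2 - z)) (((quasiSplit F E c 3).toAdelic (weylLongU (c : E →+* E) (rfl : (StdForm.antidiagonal 3).over E = (StdForm.antidiagonal 3).over E)))⁻¹ * ((u : (quasiSplit F E c 3).Adelic) * g)) = flatSectionU φ z ((quasiSplit F E c 3).toAdelic (weylLongU (c : E →+* E) (rfl : (StdForm.antidiagonal 3).over E = (StdForm.antidiagonal 3).over E)) * ((u : (quasiSplit F E c 3).Adelic) * g)) := by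
      intro u
      have hnot := not_lt_borelHeight_weylLongU_unipotent_mul u.2 hT hg
      rw [mul_assoc] at hnot
      rw [hW, indicator_of_mem (show (quasiSplit F E c 3).toAdelic (weylLongU (c : E →+* E) (rfl : (StdForm.antidiagonal 3).over E = (StdForm.antidiagonal 3).over E)) * ((u : (quasiSplit F E c 3).Adelic) * g) ∈ {y : (quasiSplit F E c 3).Adelic | borelHeight y ≤ T} from not_lt.1 hnot), indicator_of_notMem (show (quasiSplit F E c 3).toAdelic (weylLongU (c : E →+* E) (rfl : (StdForm.antidiagonal 3).over E = (StdForm.antidiagonal 3).over E)) * ((u : (quasiSplit F E c 3).Adelic) * g) ∉ {y : (quasiSplit F E c 3).Adelic | T < borelHeight y} from hnot), sub_zero]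
    simp_rw [hpt]
    exact hMf g
  -- (4) the cut-off `χ = 𝟙_{H>T}·(f′ + f̃′)`: Borel, left-`N(𝔸)`∕`B(F)`-invariant, dominated by `H^{z′}`
  have hSgt : MeasurableSet {y : (quasiSplit F E c 3).Adelic | T < borelHeight y} := measurableSet_lt measurable_const measurable_borelHeight
  have hχm : Measurable ({y : (quasiSplit F E c 3).Adelic | T < borelHeight y}.indicator (flatSectionU φ' z' + flatSectionU φt' (2 - z'))) := ((measurable_flatSectionU hφ'm z').add (measurable_flatSectionU hφt'm (2 - z'))).indicator hSgt
  have hsumN : ∀ (u : ↥(adelicUnipotent F E c 3)) (x : (quasiSplit F E c 3).Adelic), (flatSectionU φ' z' + flatSectionU φt' (2 - z')) ((u : (quasiSplit F E c 3).Adelic) * x) = (flatSectionU φ' z' + flatSectionU φt' (2 - z')) x := fun u x => by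
    rw [Pi.add_apply, Pi.add_apply, hfN' hφ'N z' u x, hfN' hφt'N (2 - z') u x]
  have hχN : ∀ (u : ↥(adelicUnipotent F E c 3)) (x : (quasiSplit F E c 3).Adelic), {y : (quasiSplit F E c 3).Adelic | T < borelHeight y}.indicator (flatSectionU φ' z' + flatSectionU φt' (2 - z')) ((u : (quasiSplit F E c 3).Adelic) * x) = {y : (quasiSplit F E c 3).Adelic | T < borelHeight y}.indicator (flatSectionU φ' z' + flatSectionU φt' (2 - z')) x := fun u x =>
    (indicator_height_apply_eq (borelHeight_unipotent_mul u.2 x) (hsumN u x)).2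
  have hsumB : ∀ b ∈ arithmeticBorel F E c 3, ∀ x : (quasiSplit F E c 3).Adelic, (flatSectionU φ' z' + flatSectionU φt' (2 - z')) ((b : (quasiSplit F E c 3).Adelic) * x) = (flatSectionU φ' z' + flatSectionU φt' (2 - z')) x := fun b hb x => by
    rw [Pi.add_apply, Pi.add_apply, hfB hφ'B z' b hb x, hfB hφt'B (2 - z') b hb x]
  have hχB : ∀ b ∈ arithmeticBorel F E c 3, ∀ x : (quasiSplit F E c 3).Adelic, {y : (quasiSplit F E c 3).Adelic | T < borelHeight y}.indicator (flatSectionU φ' z' + flatSectionU φt' (2 - z')) ((b : (quasiSplit F E c 3).Adelic) * x) = {y : (quasiSplit F E c 3).Adelic | T < borelHeight y}.indicator (flatSectionU φ' z' + flatSectionU φt' (2 - z')) x := forall_arithmeticBorel_indicator hsumB (fun h => T < h)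
  have hfinχ := fun g : (quasiSplit F E c 3).Adelic => hfin_of_norm_le (add_nonneg hCφ' (mul_nonneg hCφt' (Real.rpow_nonneg (NNReal.coe_nonneg T) _)))
    (norm_indicator_lt_add_flatSectionU_le hφ'C hφt'C hT0 (by linarith : 1 ≤ z'.re)) g (hfinz' g)
  -- (5) `hCT′`: high points by ★ R6c and ★ R6a; low points by `Λ′ = E(f′) − Ψ(χ)`, `Ψ(χ) = E(χ)`, linearity and ★ R3 for `f′` and `χ`
  have hCT' : ∀ g : (quasiSplit F E c 3).Adelic, borelConstantTerm ν 𝓕 (truncation ν 𝓕 T (eisensteinSeriesU (flatSectionU φ' z'))) g =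
      {y : (quasiSplit F E c 3).Adelic | borelHeight y ≤ T}.indicator (flatSectionU φ' z' + flatSectionU φt' (2 - z')) g - (∫ u : ↥(adelicUnipotent F E c 3), {y : (quasiSplit F E c 3).Adelic | T < borelHeight y}.indicator (flatSectionU φ' z' + flatSectionU φt' (2 - z')) ((quasiSplit F E c 3).toAdelic (weylLongU (c : E →+* E) (rfl : (StdForm.antidiagonal 3).over E = (StdForm.antidiagonal 3).over E)) * ((u : (quasiSplit F E c 3).Adelic) * g)) ∂ν) := by
    intro g
    by_cases hg : T < borelHeight g
    · have h0 : (fun u : ↥(adelicUnipotent F E c 3) => {y : (quasiSplit F E c 3).Adelic | T < borelHeight y}.indicator (flatSectionU φ' z' + flatSectionU φt' (2 - z')) ((quasiSplit F E c 3).toAdelic (weylLongU (c : E →+* E) (rfl : (StdForm.antidiagonal 3).over E = (StdForm.antidiagonal 3).over E)) * ((u : (quasiSplit F E c 3).Adelic) * g))) = fun _ => 0 := funext fun u => by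
        have hnot := not_lt_borelHeight_weylLongU_unipotent_mul u.2 hT hg
        rw [mul_assoc] at hnot
        exact indicator_of_notMem (show (quasiSplit F E c 3).toAdelic (weylLongU (c : E →+* E) (rfl : (StdForm.antidiagonal 3).over E = (StdForm.antidiagonal 3).over E)) * ((u : (quasiSplit F E c 3).Adelic) * g) ∉ {y : (quasiSplit F E c 3).Adelic | T < borelHeight y} from hnot) _
      rw [borelConstantTerm_truncation_eisensteinSeriesU_eq_zero_of_lt_three hT (hfB hφ'B z') (hfB hφt'B (2 - z')) (hfN hφ'N z') (hfN hφt'N (2 - z')) (fun x _ => hCTf' x)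
          h𝓕₀ h𝓕top (hint' g) hg,
        indicator_of_notMem (show g ∉ {y : (quasiSplit F E c 3).Adelic | borelHeight y ≤ T} from fun h => (not_le.2 hg) h), h0, integral_zero, sub_zero]
    · have hle : borelHeight g ≤ T := not_lt.1 hg
      have hΛfun : truncation ν 𝓕 T (eisensteinSeriesU (flatSectionU φ' z')) = eisensteinSeriesU (flatSectionU φ' z') - pseudoEisenstein ({y : (quasiSplit F E c 3).Adelic | T < borelHeight y}.indicator (flatSectionU φ' z' + flatSectionU φt' (2 - z'))) := by
        funext y
        rw [Pi.sub_apply, truncation_def, constantTermTail_eisensteinSeriesU_eq (fun x _ => hCTf' x), ← Set.indicator_add']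
      have hPfun : pseudoEisenstein ({y : (quasiSplit F E c 3).Adelic | T < borelHeight y}.indicator (flatSectionU φ' z' + flatSectionU φt' (2 - z'))) = eisensteinSeriesU ({y : (quasiSplit F E c 3).Adelic | T < borelHeight y}.indicator (flatSectionU φ' z' + flatSectionU φt' (2 - z'))) :=
        funext fun y => pseudoEisenstein_eq_eisensteinSeriesU' hχB y (finite_support_indicator_out_mul siegel_three hT _ y)
      have hmeas : Measurable fun u : ↥(adelicUnipotent F E c 3) => (u : (quasiSplit F E c 3).Adelic) * g := (continuous_subtype_val.mul continuous_const).measurable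
      have hIΛ : IntegrableOn (fun u : ↥(adelicUnipotent F E c 3) => truncation ν 𝓕 T (eisensteinSeriesU (flatSectionU φ' z')) ((u : (quasiSplit F E c 3).Adelic) * g)) 𝓕 ν :=
        Measure.integrableOn_of_bounded (M := M₁) h𝓕top (hΛm.comp hmeas).aestronglyMeasurable (Eventually.of_forall fun u => hΛbdd _)
      have hIP : IntegrableOn (fun u : ↥(adelicUnipotent F E c 3) => pseudoEisenstein ({y : (quasiSplit F E c 3).Adelic | T < borelHeight y}.indicator (flatSectionU φ' z' + flatSectionU φt' (2 - z'))) ((u : (quasiSplit F E c 3).Adelic) * g)) 𝓕 ν := by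
        have h' : (fun u : ↥(adelicUnipotent F E c 3) => pseudoEisenstein ({y : (quasiSplit F E c 3).Adelic | T < borelHeight y}.indicator (flatSectionU φ' z' + flatSectionU φt' (2 - z'))) ((u : (quasiSplit F E c 3).Adelic) * g)) =
            fun u : ↥(adelicUnipotent F E c 3) => eisensteinSeriesU (flatSectionU φ' z') ((u : (quasiSplit F E c 3).Adelic) * g) - truncation ν 𝓕 T (eisensteinSeriesU (flatSectionU φ' z')) ((u : (quasiSplit F E c 3).Adelic) * g) := by
          funext u
          rw [hΛfun, Pi.sub_apply, sub_sub_cancel]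
        rw [h']
        exact (hint' g).sub hIΛ
      rw [hΛfun, borelConstantTerm_sub ν 𝓕 g (hint' g) hIP, hCTf' g, hPfun,
        borelConstantTerm_eisensteinSeriesU_three ν hχm hχN (forall_arithmeticBorel_iff.1 hχB) h𝓕N h𝓕₀ h𝓕top g (hfinχ g), h𝓕1, ENNReal.toReal_one, inv_one, one_smul,
        indicator_of_notMem (show g ∉ {y : (quasiSplit F E c 3).Adelic | T < borelHeight y} from hg), zero_add, indicator_of_mem (show g ∈ {y : (quasiSplit F E c 3).Adelic | borelHeight y ≤ T} from hle), Pi.add_apply]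
      simp_rw [mul_assoc]
  exact hAdj hβ hT hφm hφN hφB hφC hφ'm hφ'N hφ'B hφ'C hφtm hφtN hφtB hφtC hφt'm hφt'N hφt'B hφt'C hz' hzz' (fun x _ => hCTf x) hsum hΛm hΛG hΛbdd hψL1
    hCT' hM'ψ hi₅ habs habs' hΞ₁m hΞ₁C hΞ₁K hΞ₁M hΞ₁ hΞ₂m hΞ₂C hΞ₂K hΞ₂M hΞ₂ hΞ₃m hΞ₃C hΞ₃K hΞ₃M hΞ₃ hΞ₄m hΞ₄C hΞ₄K hΞ₄M hΞ₄

end ConstantTerms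

end Summit.HodgeConjecture.HodgeConjecture.Cruxes.H413.K2E1MaassSelbergCMThreeConstantTerms

end
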